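import Mathlib.Dynamics.PeriodicPts.Defs
import Mathlib.NumberTheory.ArithmeticFunction.Moebius
import Mathlib.Data.Set.Card
import HarnessLib

/-!
# Points of least period `n` of a self-map: `Fix_T(n) = Σ_{d ∣ n} L_T(d)`, `n ∣ L_T(n)`, Möbius inversion
# `L_T(n) = Σ_{d ∣ n} μ(n/d) Fix_T(d)` and the Dold congruences (Byszewski–Graff–Ward 2021, Lemma 3.4)

Printed statements.  J. Byszewski, G. Graff, T. Ward, *Dold sequences, periodic points, and dynamics*, Bull.
London Math. Soc. 53 (2021) 1263–1298 (held `paper:arxiv-2007.04031`, text chunks): §3.1 (chunk p0008) «If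
`T^k x = x` for some `k ≥ 1` … the least period (or minimal period) of a periodic point `x` is
`min{k ∈ ℕ ∣ T^k x = x}`. We write `F_T(n) = {x ∈ X ∣ Tⁿx = x}` … and `Fix_T(n) = |F_T(n)|` for the number of
points fixed by the `n`th iterate of `T`, or (equivalently) the number of points that are periodic with least
period dividing `n`. We also write `L_T(n)` for the number of points in `F_T(n)` with least period `n`, so
`n O_T(n) = L_T(n)` for all `n ≥ 1`» (`O_T(n)` the number of closed orbits of length `n`); **Lemma 3.4** (chunk
p0008) «Let `T : X → X` be a map. Then `Fix_T(n) = Σ_{d|n} d O_T(d)` and so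
`O_T(n) = (1/n) Σ_{d|n} μ(n/d) Fix_T(d)`. *Proof.* Any point fixed by `Tⁿ` must live on a closed orbit of length
`d` for some `d` dividing `n`, so `F_T(n)` is the disjoint union of these closed orbits, and the number of points
that live on closed orbits of length `d` is `d O_T(d)`»; **Definition 2.1** (chunk p0004) «An integer sequence
`(a_n)` is called a Dold sequence if `Σ_{d|n} μ(n/d) a_d ≡ 0` modulo `n` for all `n ≥ 1`»; §4.1 (chunk p0010)
«a sequence `(a_n)` is realizable if and only if `(1/n) Σ_{d|n} μ(n/d) a_d ∈ ℕ₀` for all `n ≥ 1` … Thus a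
realizable sequence is a Dold sequence».

For a self-map `T : X → X` of a type, `n : ℕ` and Mathlib's `Function.minimalPeriod` (least period, `0` for
non-periodic points), write `Fix_T(n) := Nat.card (fixedPoints T^[n])` (the number of points fixed by `T^[n]` if
finite, `0` if not) and `L_T(n) := Nat.card {x | minimalPeriod T x = n}`.  This file proves (theorems only; no
definition, no named fact):

* `fixedPoints_iterate_subset_of_dvd` (`F_T(m) ⊆ F_T(n)` for `m ∣ n`), `setOf_minimalPeriod_eq_subset_fixedPoints_iterate`;
* **`dvd_natCard_setOf_minimalPeriod_eq`**: `n ∣ L_T(n)` for every `n ≥ 1` (the points of least period `n` split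
  into closed orbits of length exactly `n`; no finiteness hypothesis — an infinite set has `Nat.card = 0`);
* **`natCard_fixedPoints_iterate_eq_sum`**: `Fix_T(n) = Σ_{d ∣ n} L_T(d)` when `F_T(n)` is finite, `n ≥ 1`;
* **`sum_moebius_mul_natCard_fixedPoints_iterate_eq`**: `Σ_{d ∣ n} μ(n/d) Fix_T(d) = L_T(n)` (Möbius inversion on the
  divisor-closed set `{m ∣ n}`, Mathlib `ArithmeticFunction.sum_eq_iff_sum_mul_moebius_eq_on`), when `F_T(n)` is finite;
* **`dvd_sum_moebius_mul_natCard_fixedPoints_iterate`**: the Dold congruence `n ∣ Σ_{d ∣ n} μ(n/d) Fix_T(d)` when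
  `F_T(n)` is finite, and `dold_natCard_fixedPoints_iterate` («a realizable sequence is a Dold sequence»: all
  `n ≥ 1` when every `F_T(n)` is finite).

(The tree's `NumberTheory/LFunctions/DworkRationalityIntegralityProofs.lean` has the orbit–cycle bookkeeping for
PERMUTATIONS (`fixCount_eq_sum_cycleCount`) and the Euler-product integrality of the dynamical zeta function; here
`T` is an arbitrary, possibly non-injective, self-map and the statements are the least-period / Möbius forms.)

## References

* [ByszewskiGraffWard2021] J. Byszewski, G. Graff, T. Ward, *Dold sequences, periodic points, and dynamics*,
  Bull. London Math. Soc. 53 (2021) 1263–1298, Def. 2.1, §3.1, Lemma 3.4, §4.1 (held text chunks p0004, p0008, p0010).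
-/

namespace Literature.Dynamics.FixedPoints

open Function Finset

variable {X : Type*} (T : X → X)

/-- `F_T(m) ⊆ F_T(n)` whenever `m ∣ n` (a point of period `m` has period every multiple of `m`).
[cite: ByszewskiGraffWard2021, §3.1 (text chunk p0008)] -/
theorem fixedPoints_iterate_subset_of_dvd {m n : ℕ} (h : m ∣ n) : fixedPoints T^[m] ⊆ fixedPoints T^[n] := by
  obtain ⟨k, rfl⟩ := h
  exact fun x hx ↦ IsPeriodicPt.mul_const hx k

/-- The points of least period `d` lie in `F_T(n)` for every multiple `n` of `d` («the number of points that are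
periodic with least period dividing `n`»). [cite: ByszewskiGraffWard2021, §3.1 (text chunk p0008)] -/
theorem setOf_minimalPeriod_eq_subset_fixedPoints_iterate {d n : ℕ} (h : d ∣ n) :
    {x | minimalPeriod T x = d} ⊆ fixedPoints T^[n] := by
  obtain ⟨k, rfl⟩ := h
  intro x hx
  rw [Set.mem_setOf_eq] at hx
  exact (hx ▸ isPeriodicPt_minimalPeriod T x).mul_const k

/-- **`n ∣ L_T(n)`: the number of points of least period `n ≥ 1` is a multiple of `n`** («`n O_T(n) = L_T(n)`»:
the set of points of least period `n` is the disjoint union of the closed orbits of length exactly `n`, each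
orbit `{x, Tx, …, T^{n-1}x}` having `n` distinct points).  As `Nat.card` (an infinite set counts `0`), no
finiteness hypothesis is needed. [cite: ByszewskiGraffWard2021, §3.1 and Lemma 3.4 (text chunk p0008)] -/
theorem dvd_natCard_setOf_minimalPeriod_eq {n : ℕ} (hn : 0 < n) : n ∣ Nat.card {x | minimalPeriod T x = n} := by
  classical
  by_cases hfin : ({x | minimalPeriod T x = n} : Set X).Finite
  swap
  · haveI := Set.infinite_coe_iff.2 hfin
    rw [Nat.card_eq_zero_of_infinite]
    exact dvd_zero n
  set s : Finset X := hfin.toFinset with hs_def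
  have hs : ∀ y, y ∈ s ↔ minimalPeriod T y = n := fun y ↦ by
    rw [hs_def, Set.Finite.mem_toFinset, Set.mem_setOf_eq]
  have hcard : Nat.card {x | minimalPeriod T x = n} = s.card := by
    rw [Nat.card_coe_set_eq, Set.ncard_eq_toFinset_card _ hfin]
  rw [hcard, Finset.card_eq_sum_card_fiberwise (f := periodicOrbit T) (s := s) (t := s.image (periodicOrbit T))
    fun x hx ↦ Finset.mem_image_of_mem _ hx]
  refine Finset.dvd_sum fun c hc ↦ ?_
  obtain ⟨x₀, hx₀, rfl⟩ := Finset.mem_image.1 hc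
  have hn₀ : minimalPeriod T x₀ = n := (hs x₀).1 hx₀
  have hper : x₀ ∈ periodicPts T := minimalPeriod_pos_iff_mem_periodicPts.1 (hn₀ ▸ hn)
  have hfib : s.filter (fun y ↦ periodicOrbit T y = periodicOrbit T x₀) = (range n).image (fun i ↦ T^[i] x₀) := by
    ext y
    simp only [Finset.mem_filter, Finset.mem_image, Finset.mem_range, hs]
    constructor
    · rintro ⟨hy, hyo⟩
      have hyper : y ∈ periodicPts T := minimalPeriod_pos_iff_mem_periodicPts.1 (hy ▸ hn)
      have hmem : y ∈ periodicOrbit T x₀ := by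
        rw [← hyo]
        exact self_mem_periodicOrbit hyper
      obtain ⟨i, rfl⟩ := (mem_periodicOrbit_iff hper).1 hmem
      exact ⟨i % n, Nat.mod_lt i hn, (hn₀ ▸ isPeriodicPt_minimalPeriod T x₀).iterate_mod_apply i⟩
    · rintro ⟨i, -, rfl⟩
      exact ⟨by rw [minimalPeriod_apply_iterate hper, hn₀], periodicOrbit_apply_iterate_eq hper i⟩
  rw [hfib, Finset.card_image_of_injOn, Finset.card_range]
  rw [Finset.coe_range, ← hn₀]
  exact iterate_injOn_Iio_minimalPeriod

/-- **`Fix_T(n) = Σ_{d ∣ n} L_T(d)`** for `n ≥ 1` when `F_T(n)` is finite — «any point fixed by `Tⁿ` must live on a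
closed orbit of length `d` for some `d` dividing `n`, so `F_T(n)` is the disjoint union of these closed orbits»
(first half of Lemma 3.4, with `L_T(d) = d O_T(d)`). [cite: ByszewskiGraffWard2021, Lemma 3.4 (text chunk p0008)] -/
theorem natCard_fixedPoints_iterate_eq_sum {n : ℕ} (hn : 0 < n) (hfin : (fixedPoints T^[n]).Finite) :
    Nat.card (fixedPoints T^[n]) = ∑ d ∈ n.divisors, Nat.card {x | minimalPeriod T x = d} := by
  classical
  set s : Finset X := hfin.toFinset with hs_def
  have hs : ∀ y, y ∈ s ↔ IsPeriodicPt T n y := fun y ↦ by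
    rw [hs_def, Set.Finite.mem_toFinset, mem_fixedPoints]
    rfl
  have hcard : Nat.card (fixedPoints T^[n]) = s.card := by
    rw [Nat.card_coe_set_eq, Set.ncard_eq_toFinset_card _ hfin]
  rw [hcard, Finset.card_eq_sum_card_fiberwise (f := minimalPeriod T) (s := s) (t := n.divisors) fun x hx ↦
    Nat.mem_divisors.2 ⟨((hs x).1 hx).minimalPeriod_dvd, hn.ne'⟩]
  refine Finset.sum_congr rfl fun d hd ↦ ?_
  have hdn : d ∣ n := Nat.dvd_of_mem_divisors hd
  have hset : ({x | minimalPeriod T x = d} : Set X) = ↑(s.filter fun x ↦ minimalPeriod T x = d) := by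
    ext x
    simp only [Set.mem_setOf_eq, Finset.coe_filter, hs]
    refine ⟨fun hx ↦ ⟨?_, hx⟩, fun hx ↦ hx.2⟩
    obtain ⟨k, rfl⟩ := hdn
    exact (hx ▸ isPeriodicPt_minimalPeriod T x).mul_const k
  rw [hset, Nat.card_coe_set_eq, Set.ncard_coe_finset]

/-- **Möbius inversion: `Σ_{d ∣ n} μ(n/d) Fix_T(d) = L_T(n)`** for `n ≥ 1` when `F_T(n)` is finite (then every
`F_T(d)`, `d ∣ n`, is finite and `Fix_T(d) = Σ_{e ∣ d} L_T(e)`; Möbius inversion on the divisor-closed set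
`{d : d ∣ n}`) — Lemma 3.4's «`O_T(n) = (1/n) Σ_{d|n} μ(n/d) Fix_T(d)`» multiplied by `n`.
[cite: ByszewskiGraffWard2021, Lemma 3.4 (text chunk p0008)] -/
theorem sum_moebius_mul_natCard_fixedPoints_iterate_eq {n : ℕ} (hn : 0 < n) (hfin : (fixedPoints T^[n]).Finite) :
    ∑ d ∈ n.divisors, (ArithmeticFunction.moebius (n / d) : ℤ) * (Nat.card (fixedPoints T^[d]) : ℤ) =
      Nat.card {x | minimalPeriod T x = n} := by
  rw [← Nat.sum_divisorsAntidiagonal' (f := fun a b ↦ (ArithmeticFunction.moebius a : ℤ) *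
    (Nat.card (fixedPoints T^[b]) : ℤ))]
  refine (ArithmeticFunction.sum_eq_iff_sum_mul_moebius_eq_on (R := ℤ)
    (f := fun d ↦ (Nat.card {x | minimalPeriod T x = d} : ℤ)) (g := fun m ↦ (Nat.card (fixedPoints T^[m]) : ℤ))
    {m | m ∣ n} (fun a b hab hb ↦ hab.trans hb)).1 (fun m hm hmn ↦ ?_) n hn (dvd_refl n)
  have hfinm : (fixedPoints T^[m]).Finite := hfin.subset (fixedPoints_iterate_subset_of_dvd T hmn)
  exact_mod_cast (natCard_fixedPoints_iterate_eq_sum T hm hfinm).symm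

/-- **The Dold congruence `n ∣ Σ_{d ∣ n} μ(n/d) Fix_T(d)`** at every `n ≥ 1` with `F_T(n)` finite (the sum is
`L_T(n) = n O_T(n)`). [cite: ByszewskiGraffWard2021, Def. 2.1 and Lemma 3.4 (text chunks p0004, p0008)] -/
theorem dvd_sum_moebius_mul_natCard_fixedPoints_iterate {n : ℕ} (hn : 0 < n) (hfin : (fixedPoints T^[n]).Finite) :
    (n : ℤ) ∣ ∑ d ∈ n.divisors, (ArithmeticFunction.moebius (n / d) : ℤ) * (Nat.card (fixedPoints T^[d]) : ℤ) := by
  rw [sum_moebius_mul_natCard_fixedPoints_iterate_eq T hn hfin]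
  exact_mod_cast dvd_natCard_setOf_minimalPeriod_eq T hn

/-- **«A realizable sequence is a Dold sequence»**: if every `F_T(n)`, `n ≥ 1`, is finite, then the sequence
`(Fix_T(n))_{n ≥ 1}` of fixed-point counts of the iterates satisfies `Σ_{d ∣ n} μ(n/d) Fix_T(d) ≡ 0 (mod n)` for
all `n ≥ 1`. [cite: ByszewskiGraffWard2021, Def. 2.1, Def. 4.1 and §4.1 (text chunks p0004, p0010)] -/
theorem dold_natCard_fixedPoints_iterate (hfin : ∀ n, 0 < n → (fixedPoints T^[n]).Finite) {n : ℕ} (hn : 0 < n) :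
    (n : ℤ) ∣ ∑ d ∈ n.divisors, (ArithmeticFunction.moebius (n / d) : ℤ) * (Nat.card (fixedPoints T^[d]) : ℤ) :=
  dvd_sum_moebius_mul_natCard_fixedPoints_iterate T hn (hfin n hn)

/-- **`0 ≤ Σ_{d ∣ n} μ(n/d) Fix_T(d)`** (the non-negativity half of realizability: the sum is `L_T(n) ≥ 0`), for
`n ≥ 1` with `F_T(n)` finite. [cite: ByszewskiGraffWard2021, §4.1 (text chunk p0010)] -/
theorem sum_moebius_mul_natCard_fixedPoints_iterate_nonneg {n : ℕ} (hn : 0 < n)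
    (hfin : (fixedPoints T^[n]).Finite) :
    0 ≤ ∑ d ∈ n.divisors, (ArithmeticFunction.moebius (n / d) : ℤ) * (Nat.card (fixedPoints T^[d]) : ℤ) := by
  rw [sum_moebius_mul_natCard_fixedPoints_iterate_eq T hn hfin]
  exact Int.natCast_nonneg _

/-- **`L_T(n) ≤ Fix_T(n)`** for `n ≥ 1` with `F_T(n)` finite (the points of least period `n` are among the points
fixed by `T^[n]`). [cite: ByszewskiGraffWard2021, §3.1 (text chunk p0008)] -/
theorem natCard_setOf_minimalPeriod_eq_le {n : ℕ} (hfin : (fixedPoints T^[n]).Finite) :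
    Nat.card {x | minimalPeriod T x = n} ≤ Nat.card (fixedPoints T^[n]) := by
  rw [Nat.card_coe_set_eq, Nat.card_coe_set_eq]
  exact Set.ncard_le_ncard (setOf_minimalPeriod_eq_subset_fixedPoints_iterate T (dvd_refl n)) hfin

end Literature.Dynamics.FixedPoints
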